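import Mathlib
import HarnessLib.Audit
import Summits.PneNP.PneNP.Theorems.PstarCrossNoCompanion
import Summits.PneNP.PneNP.Theorems.PstarCrossLevelOneSingle
import Summits.PneNP.PneNP.Theorems.PstarCrossCaseP

/-!
# The blind free CROSS gate, regime P (node N2): an (EQ) chord leaves at most five core outputs — the (EQ) row of N2 is CLOSED (O2 / E1; prover-1 g23)

FRONTIER range-avoidance ladder, rung F-N3 (`stmt-PneNP-19007`), cell `pnp-ideate`; restricted-model proof complexity — nothing here bears on `P` versus `NP`.

Node N2 (`PstarCrossNodes.CrossCasePChords`): regime P (the virtual system is single-read, `q := q_{(1,0)}`), with a real chord `e` that is (EQ) in the sense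
of `PstarCrossCaseP.forced_cases_real` (`Q_{D e} = q + κ`).  Since every real chord is ON on `Z(q)` (`u_of_q`) and `Z(q) ≠ ∅` (`exists_q_p`), in fact
`u_e = q + 1`: the level set `{u_e = 1}` IS `Z(q)`.  Hence:

* `crossCaseP_eq_no_other` — `e` is the only real chord (`PstarCrossNoCompanion.no_companion` with `mv = (1,0)`: every other real chord is ON on `{u_e = 1}`);
* both state-free parts are pinned on `{u_e = 1}`: `q_{(1,0)} = 0` there by definition and `q_{(0,1)} = 1 + σ₁` by `PstarCrossCaseP.qDir01_of_q`;
* **`crossCaseP_eq`** — so `PstarCrossLevelOneSingle.single_level_one` gives `#J₀ ≤ 5`.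
What remains of N2: every real chord is (EXC) — then a unit by `PstarNorUnitExcCore.exc_unit_core` against `q` — or (NOR) w.r.t. `q`.
-/

set_option linter.dupNamespace false -- `Summit.PneNP.PneNP.…`: summit = sub-problem name (D-0017 single-conjunct layout)

open Finset Module Literature.Computability.Complexity
open Summit.PneNP.PneNP.Theorems.PstarTyped (Typed)
open Summit.PneNP.PneNP.Theorems.PstarSALevel (BoundaryExpanding SimpleOverlap)
open Summit.PneNP.PneNP.Theorems.PstarProductRank (qform polar)
open Summit.PneNP.PneNP.Theorems.PstarReadSumset (V2)
open Summit.PneNP.PneNP.Theorems.PstarChordSystem (ChordSystem)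
open Summit.PneNP.PneNP.Theorems.PstarChordBridge
open Summit.PneNP.PneNP.Theorems.PstarChordBridgeForcing (gam sys_u_eq)
open Summit.PneNP.PneNP.Theorems.PstarChordBridgeBasis (qDir)
open Summit.PneNP.PneNP.Theorems.PstarCrossData (CrossData)
open Summit.PneNP.PneNP.Theorems.PstarCrossSystem
open Summit.PneNP.PneNP.Theorems.PstarCrossCaseP (qDir10_eq u_of_q qDir01_of_q exists_q_p)
open Summit.PneNP.PneNP.Theorems.PstarCrossNoCompanion (no_companion)
open Summit.PneNP.PneNP.Theorems.PstarCrossLevelOneSingle (single_level_one)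

namespace Summit.PneNP.PneNP.Theorems.PstarCrossCasePEq

variable {n m : ℕ}

section

variable (I : LocalMap 4 n m) {r : ℕ} {B : BridgeData n m} {e_p e_q g₀ : Fin m}

/-- **In regime P an (EQ) chord has `u_e = q_{(1,0)} + 1`.** -/
theorem u_eq_q_add_one (hI : I.IsPure xorAndPred) (hT : Typed I) (hD : CrossData I r B e_p e_q g₀) (hSR : ((sys I B).vsys e_p e_q).SingleRead)
    {e : Fin m} (he : e ∈ (B.N.erase e_q).erase e_p)
    (hEQ : ∃ κ : ZMod 2, ∀ x, qform (B.D e) (fun j => I.vars j 2) (fun j => I.vars j 3) x = (((sys I B).F x).2 + (sys I B).t.2) + κ) :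
    ∀ x, qDir I B (1, 0) x + 1 = (sys I B).u e x := by
  obtain ⟨κ, hκ⟩ := hEQ
  have heq : e ∈ B.N.erase e_q := mem_of_mem_erase he
  have hne : e ≠ e_p := ne_of_mem_erase he
  -- `u_e = q + (γ_e + κ)` everywhere
  have hu : ∀ x, (sys I B).u e x = qDir I B (1, 0) x + (gam B e + κ) := fun x => by
    rw [sys_u_eq, hκ x, qDir10_eq I B e_p e_q]
    simp only [ChordSystem.vsys_F, ChordSystem.vsys_t]
    have e3 : ∀ g a b k : ZMod 2, g + (a + b + k) = a + b + (g + k) := by decide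
    exact e3 _ _ _ _
  -- at a zero of `q` the chord is ON: the constant is `1`
  obtain ⟨a, ha, -, -⟩ := exists_q_p I hI hT hD hSR
  have h1 := u_of_q I hI hT hD hSR heq hne ha
  rw [hu a, ha, zero_add] at h1
  intro x
  rw [hu x, h1]

/-- **In regime P an (EQ) chord is the only real chord.** -/
theorem crossCaseP_eq_no_other (hI : I.IsPure xorAndPred) (hT : Typed I) (hS : SimpleOverlap I) (hB : BoundaryExpanding r I)
    (hD : CrossData I r B e_p e_q g₀) (hSR : ((sys I B).vsys e_p e_q).SingleRead) {e : Fin m} (he : e ∈ (B.N.erase e_q).erase e_p)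
    (hEQ : ∃ κ : ZMod 2, ∀ x, qform (B.D e) (fun j => I.vars j 2) (fun j => I.vars j 3) x = (((sys I B).F x).2 + (sys I B).t.2) + κ)
    {e₂ : Fin m} (he₂ : e₂ ∈ (B.N.erase e_q).erase e_p) (hne : e₂ ≠ e) : False := by
  have hq := u_eq_q_add_one I hI hT hD hSR he hEQ
  refine no_companion I hI hS hB hD (mv := (1, 0)) (κ := 1) (mem_of_mem_erase (mem_of_mem_erase he)) hq
    (mem_of_mem_erase (mem_of_mem_erase he₂)) hne fun x hx => ?_
  have hqx : qDir I B (1, 0) x = 0 := by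
    have h := hq x
    rw [hx] at h
    have e : ∀ a : ZMod 2, a + 1 = 1 → a = 0 := by decide
    exact e _ h
  exact u_of_q I hI hT hD hSR (mem_of_mem_erase he₂) (ne_of_mem_erase he₂) hqx

/-- **Regime P with an (EQ) chord has at most five core outputs** — the (EQ) row of node N2 is closed. -/
theorem crossCaseP_eq (hI : I.IsPure xorAndPred) (hT : Typed I) (hS : SimpleOverlap I) (hB : BoundaryExpanding r I)
    (hD : CrossData I r B e_p e_q g₀) (hSR : ((sys I B).vsys e_p e_q).SingleRead) {e : Fin m} (he : e ∈ (B.N.erase e_q).erase e_p)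
    (hEQ : ∃ κ : ZMod 2, ∀ x, qform (B.D e) (fun j => I.vars j 2) (fun j => I.vars j 3) x = (((sys I B).F x).2 + (sys I B).t.2) + κ) :
    B.J₀.card ≤ 5 := by
  classical
  have hq := u_eq_q_add_one I hI hT hD hSR he hEQ
  have hsingle : (B.N.erase e_q).erase e_p = {e} :=
    eq_singleton_iff_unique_mem.2 ⟨he, fun e₂ he₂ => by
      by_contra hne
      exact crossCaseP_eq_no_other I hI hT hS hB hD hSR he hEQ he₂ hne⟩
  have hqx : ∀ x, (sys I B).u e x = 1 → qDir I B (1, 0) x = 0 := fun x hx => by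
    have h := hq x
    rw [hx] at h
    have e : ∀ a : ZMod 2, a + 1 = 1 → a = 0 := by decide
    exact e _ h
  set κ₁ : ZMod 2 := 1 + ∑ e' ∈ B.N.erase e_q, ((((sys I B).vsys e_p e_q).ρ e' 0).1 + (((sys I B).vsys e_p e_q).ρ' e' 0).1) with hκ₁
  refine single_level_one I hI hT hS hB hD hsingle (κ₁ := κ₁) (κ₂ := 0) (fun x hx => ?_) (fun x hx => by rw [hqx x hx, add_zero])
  have hconst := vsys_const I hD
  rw [qDir01_of_q I hI hT hD hSR (hqx x hx), hκ₁, sum_congr rfl fun e' _ => by rw [(hconst e' x 0).1, (hconst e' x 0).2]]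
  exact CharTwo.add_self_eq_zero _

end

end Summit.PneNP.PneNP.Theorems.PstarCrossCasePEq
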